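import Literature.Probability.LatticeModels.FKIsingNaturalMartingale
import Literature.Probability.LatticeModels.FKIsingInterfaceSLEAssembly
import Literature.Probability.LatticeModels.FKIsingInterfaceTightnessProofs
import Literature.Probability.RandomPlanarGeometry.SLEUniquenessInLaw
import Literature.Probability.RandomPlanarGeometry.RohdeSchrammCor35Proofs
import Literature.Probability.Process.LevyCharacterisation
import HarnessLib

/-!
# FK-Ising interfaces and SLE_{16/3}: crit-ising.S17 (FK) from its current named-fact frontier

Topic `Literature/Probability/LatticeModels` (family `crit-ising`). Bookkeeping file for the
decomposition of the named fact
`Literature.Probability.LatticeModels.convergesInLawToSLE_sixteen_thirds_fkInterface`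
(**crit-ising.S17**, FK half; Chelkak–Duminil-Copin–Hongler–Kemppainen–Smirnov, C. R. Math. 352
(2014), Thm. 2: the critical FK-Ising Dobrushin interfaces converge in law to chordal
SLE_{16/3}). The layer-4 assembly `convergesInLawToSLE_sixteen_thirds_fkInterface_of_layer4`
(`FKIsingObservableMartingale.lean`) derives S17 (FK) from six named facts, with every reduction
in between PROVED (layers 1–4: `FKIsingInterfaceSLE`, `FKIsingInterfaceTightness`,
`FKIsingInterfaceIdentification`, `FKIsingDrivingMartingale`, `FKIsingObservableMartingale`, and
the monotone-class / optional-stopping bridge of `FKIsingNaturalMartingale`). Two of the six are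
theorems of the tree:

* uniqueness in law of chordal SLE_κ in a Dobrushin domain, `IsSLECurve.map_eq` —
  `RandomPlanarGeometry.IsSLECurve.map_eq_holds` (`RandomPlanarGeometry/SLEUniquenessInLaw.lean`);
* Lévy's characterisation of Brownian motion, `Process.levy_characterisation` —
  `Process.levy_characterisation_holds` (`Process/LevyCharacterisation.lean`).

This file records the resulting assembly **`convergesInLawToSLE_sixteen_thirds_fkInterface_of_frontier`**
(PROVED): crit-ising.S17 (FK) follows from the four remaining named facts

1. `RandomPlanarGeometry.hasSLETrace_of_ne_eight` — chordal SLE_κ, `κ ≠ 8`, is generated by a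
   curve (Rohde–Schramm, Ann. Math. 161 (2005), Thm. 5.1; `SLE.lean`);
2. `RandomPlanarGeometry.tendsto_norm_sleTrace_atTop` — transience of the SLE trace,
   `|γ(t)| → ∞` (Rohde–Schramm 2005, Thm. 7.1; `SLE.lean`);
3. `fkInterface_traversalBound` (C1) — the Aizenman–Burchard hypothesis for the FK-Ising
   interface, Duminil-Copin–Smirnov (2012), proof of Thm. 6.1, eq. (6.2), from the RSW bounds
   of Duminil-Copin–Hongler–Nolin (`FKIsingInterfaceTightness.lean`);
4. `exists_observableMartingale_fkInterface` (L‴) — the FK martingale observable of every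
   subsequential limit, stopped at the far-field stopping times, is a martingale for a version
   of the driving process (Duminil-Copin–Smirnov 2012, Thm. 6.4, Lemma 6.6, Thm. 3.15 and proof
   of Prop. 6.7, p. 29; CDHKS 2014, Thm. 3 and §3; `FKIsingObservableMartingale.lean`), whose
   own printed proof consists of the convergence of the driving processes (Kemppainen–Smirnov
   2017) and the discrete observable martingales with Smirnov's convergence theorem (Smirnov
   2010, Thm. 2.2), glued by the PROVED passage to the limit
   (`RandomPlanarGeometry/ObservableLimitPassage.lean`, `FKIsingCylinderIdentityAssembly.lean`).

**Update (frontier of two named facts).** Rohde–Schramm's one-point derivative estimate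
Cor. 3.5 is meanwhile a theorem of the tree on every probability space
(`RandomPlanarGeometry.RohdeSchramm2005_cor35_holds`, `RandomPlanarGeometry/RohdeSchrammCor35Proofs.lean`),
and `FKIsingInterfaceSLEAssembly.lean` reads the two Rohde–Schramm inputs of the identification
step at `κ = 16/3` only, deriving both from Cor. 3.5 (`exists_isSLECurve_sixteen_thirds`,
`isSLELaw_of_isSubseqLimitLaw_fkInterfaceCurve_of_exists_observableMartingale`). Composing gives
**`convergesInLawToSLE_sixteen_thirds_fkInterface_of_traversalBound_of_observableMartingale`**
(PROVED): crit-ising.S17 (FK) follows from facts 3 and 4 alone — the FK traversal bound (C1)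
`fkInterface_traversalBound` (Duminil-Copin–Smirnov 2012, eq. (6.2)) and the observable
martingale fact (L‴) `exists_observableMartingale_fkInterface` — which stand for the two lattice
inputs of the printed proof (the a priori RSW estimate; the convergence of the fermionic
observable with the convergence of the driving processes).

**Update (frontier = the RSW bound and (L‴)).** The traversal bound (C1) is meanwhile PROVED
from the RSW-type crossing bound alone: `fkInterface_traversalBound_of_fkIsing_rsw`
(`FKIsingInterfaceTightnessProofs.lean`: Duminil-Copin–Smirnov 2012, Thm. 3.16 ⟹ Lemma 6.3 ⟹
eqs. (6.1)–(6.2), by `fkIsing_annulusCrossing_le_of_fkIsing_rsw` and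
`fkInterface_traversalBound_of_annulusCrossing_le`). Composing once more gives
**`convergesInLawToSLE_sixteen_thirds_fkInterface_of_fkIsing_rsw_of_observableMartingale`**
(PROVED): crit-ising.S17 (FK) follows from the two named facts `fkIsing_rsw` (Duminil-Copin–
Smirnov 2012, Thm. 3.16 = Duminil-Copin–Hongler–Nolin 2011, Thm. 1: crossings of `4n × n`
rectangles under free boundary conditions have probability `≥ c`) and (L‴)
`exists_observableMartingale_fkInterface` (DCS 2012, proof of Prop. 6.7; CDHKS 2014, Thm. 3 and
§3) — standing for the printed proof's two external inputs "RSW" and "convergence of the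
observable / of the driving processes", every line in between being a theorem of the tree; and
with those two inputs of §3 as HYPOTHESES instead of (L‴), crit-ising.S17 (FK) ⟸ `fkIsing_rsw` is
`convergesInLawToSLE_sixteen_thirds_fkInterface_of_fkIsing_rsw_of_limitData'`
(`FKIsingCylinderIdentityLocal.lean`).

**D-0026 review (2026-08-15).** An earlier version of this file read the frontier one layer
lower, at CDHKS's observable martingale identity against cylinder test functions (M5′), then a
closed named fact `exists_cylinderObservableIdentity_fkInterface` of `FKIsingNaturalMartingale.lean`.
The bad-split review found (M5′) to be a step of the parent's own printed proof (the displayed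
claim of CDHKS §3, one sentence of DCS p. 29) sitting one proved lemma above two distinct
published theorems the tree does not yet hold (Kemppainen–Smirnov 2017, Thm. 1.5 with Cor. 1.7;
Smirnov 2010, Thm. 2.2 = DCS Thm. 3.15, Carathéodory-uniform form) and merged it back: below (L‴)
the printed inputs (J) ∧ (D) are THEOREM HYPOTHESES, and crit-ising.S17 (FK) from (C1) ∧ (J) ∧ (D)
is the proved `convergesInLawToSLE_sixteen_thirds_fkInterface_of_traversalBound_of_limitData`
(`FKIsingCylinderIdentityAssembly.lean`).

No statement is introduced here.

## References

* D. Chelkak, H. Duminil-Copin, C. Hongler, A. Kemppainen, S. Smirnov, *Convergence of Ising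
  interfaces to Schramm's SLE curves*, C. R. Math. Acad. Sci. Paris 352 (2014) 157–161, Thm. 2,
  Thm. 3, §3.
* H. Duminil-Copin, S. Smirnov, *Conformal invariance of lattice models*, Clay Math. Proc. 15
  (2012) 213–276: Thm. 3.13, Thm. 6.1, Lemma 6.6, Prop. 6.7.
* S. Rohde, O. Schramm, *Basic properties of SLE*, Ann. Math. 161 (2005), Thms 5.1, 7.1.
* A. Kemppainen, S. Smirnov, *Random curves, scaling limits and Loewner evolutions*, Ann.
  Probab. 45 (2017), Thm. 1.5.
* H. Duminil-Copin, C. Hongler, P. Nolin, *Connection probabilities and RSW-type bounds for the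
  two-dimensional FK Ising model*, Comm. Pure Appl. Math. 64 (2011) 1165–1198, Thm. 1.
-/

noncomputable section

namespace Literature.Probability.LatticeModels

/-- **CDHKS Theorem 2 from its current frontier of four named facts.** Crit-ising.S17 (FK half)
— convergence in law of the critical FK-Ising Dobrushin interfaces to chordal SLE_{16/3} —
follows from the Rohde–Schramm trace facts (`hasSLETrace_of_ne_eight`,
`tendsto_norm_sleTrace_atTop`), the FK traversal bound (C1) (`fkInterface_traversalBound`,
Duminil-Copin–Smirnov 2012, eq. (6.2)) and the observable martingale fact (L‴)
(`exists_observableMartingale_fkInterface`, Duminil-Copin–Smirnov 2012, proof of Prop. 6.7;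
CDHKS 2014, Thm. 3 and §3); the other two inputs of the layer-4 assembly, uniqueness in law of
chordal SLE and Lévy's characterisation of Brownian motion, are theorems of the tree
(`RandomPlanarGeometry.IsSLECurve.map_eq_holds`, `Process.levy_characterisation_holds`).
PROVED (`convergesInLawToSLE_sixteen_thirds_fkInterface_of_layer4`).
[cite: CDHKSCRAS2014, Thm. 2] [cite: DuminilCopinSmirnov2012Clay, proof of Thm. 3.13] -/
theorem convergesInLawToSLE_sixteen_thirds_fkInterface_of_frontier
    (hne : RandomPlanarGeometry.hasSLETrace_of_ne_eight)
    (htr : RandomPlanarGeometry.tendsto_norm_sleTrace_atTop)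
    (h1 : fkInterface_traversalBound) (hobs : exists_observableMartingale_fkInterface) :
    convergesInLawToSLE_sixteen_thirds_fkInterface :=
  convergesInLawToSLE_sixteen_thirds_fkInterface_of_layer4
    RandomPlanarGeometry.IsSLECurve.map_eq_holds hne htr Process.levy_characterisation_holds h1 hobs

/-- **CDHKS Theorem 2 from the two lattice facts (C1) and (L‴).** Crit-ising.S17 (FK half) —
convergence in law of the critical FK-Ising Dobrushin interfaces of a discretised Dobrushin
domain to chordal SLE_{16/3} — follows from the FK traversal bound (C1)
(`fkInterface_traversalBound`, Duminil-Copin–Smirnov 2012, proof of Thm. 6.1, eq. (6.2)) and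
the observable martingale fact (L‴) (`exists_observableMartingale_fkInterface`: the stopped FK
observable of every subsequential limit is a martingale for a version of the driving process;
DCS 2012, Thm. 6.4, Lemma 6.6, Thm. 3.15 and proof of Prop. 6.7; CDHKS 2014, Thm. 3 and §3).
All other inputs of the printed proof are theorems of the tree: Rohde–Schramm's Cor. 3.5
(`RandomPlanarGeometry.RohdeSchramm2005_cor35_holds`), hence the SLE_{16/3} trace and its
transience (`FKIsingInterfaceSLEAssembly.lean`), uniqueness in law of chordal SLE
(`RandomPlanarGeometry.IsSLECurve.map_eq_holds`), Lévy's characterisation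
(`Process.levy_characterisation_holds`), the far-field expansion, the Aizenman–Burchard criterion
and layers 1–4 of the decomposition. PROVED, by
`isSLELaw_of_isSubseqLimitLaw_fkInterfaceCurve_of_exists_observableMartingale` and the layer-1
assembly `convergesInLawToSLE_sixteen_thirds_fkInterface_of_traversalBound`.
[cite: CDHKSCRAS2014, Thm. 2] [cite: DuminilCopinSmirnov2012Clay, proof of Thm. 3.13] -/
theorem convergesInLawToSLE_sixteen_thirds_fkInterface_of_traversalBound_of_observableMartingale
    (h1 : fkInterface_traversalBound) (hobs : exists_observableMartingale_fkInterface) :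
    convergesInLawToSLE_sixteen_thirds_fkInterface :=
  convergesInLawToSLE_sixteen_thirds_fkInterface_of_traversalBound
    RandomPlanarGeometry.IsSLECurve.map_eq_holds h1
    (isSLELaw_of_isSubseqLimitLaw_fkInterfaceCurve_of_exists_observableMartingale hobs)

/-- **CDHKS Theorem 2 from the RSW bound and (L‴).** Crit-ising.S17 (FK half) — convergence in
law of the critical FK-Ising Dobrushin interfaces of a discretised Dobrushin domain to chordal
SLE_{16/3} — follows from the RSW-type crossing bound `fkIsing_rsw` (Duminil-Copin–Smirnov 2012,
Thm. 3.16; Duminil-Copin–Hongler–Nolin 2011, Thm. 1) and the observable martingale fact (L‴)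
`exists_observableMartingale_fkInterface` (DCS 2012, Thm. 6.4, Lemma 6.6, Thm. 3.15 and proof of
Prop. 6.7; CDHKS 2014, Thm. 3 and §3). The tightness half of the printed proof is entirely a
theorem of the tree above `fkIsing_rsw`: Thm. 3.16 ⟹ Lemma 6.3
(`fkIsing_annulusCrossing_le_of_fkIsing_rsw`) ⟹ the traversal bound (6.2)
(`fkInterface_traversalBound_of_fkIsing_rsw`) ⟹ tightness (Aizenman–Burchard) ⟹ subsequential
limits, identified by (L‴)
(`convergesInLawToSLE_sixteen_thirds_fkInterface_of_traversalBound_of_observableMartingale`).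
PROVED. [cite: CDHKSCRAS2014, Thm. 2] [cite: DuminilCopinSmirnov2012Clay, Thm. 6.1 (proof, §6.1) and Prop. 6.7] -/
theorem convergesInLawToSLE_sixteen_thirds_fkInterface_of_fkIsing_rsw_of_observableMartingale
    (hrsw : fkIsing_rsw) (hobs : exists_observableMartingale_fkInterface) :
    convergesInLawToSLE_sixteen_thirds_fkInterface :=
  convergesInLawToSLE_sixteen_thirds_fkInterface_of_traversalBound_of_observableMartingale
    (fkInterface_traversalBound_of_fkIsing_rsw hrsw) hobs

end Literature.Probability.LatticeModels
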